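import Literature.NumberTheory.EllipticCurves.CMBranchDualReductionCaseCRing

/-!
# CM-branch reduction of the `Λ`-dual of the Betina–Dimitrov weight-one CM Hecke algebras — case (C), the dual
# («Lemma T», kernel form; see `CMBranchDualReductionCaseCRing.lean` for the ring, the context and the honesty
# statement)

Pure commutative algebra, sorry-free, no facts. PROVED here (kernel): with `ω := Hom_Λ(𝒯, Λ) =
Module.Dual Λ (Λ⁴)`, `t·f := f ∘ₗ mulLeft t` (`(t·f)(s) = f(ts)`) and `pOmega 𝔭 := span{t·f : t ∈ 𝔭}`
(`= 𝔭ω`; `ω/𝔭ω = ω ⊗_𝒯 𝒯/𝔭`), for `𝔭 = ker pr₁` (branch (C1), `π_ψ`) and `𝔭 = ker pr₂` (branch (C2)):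
`ω ⧸ pOmega 𝔭 ≃ₗ[Λ] Λ/(X) × Λ/(X) × Λ` (`dualQuotEquiv₁/₂`, via explicit comparison maps `φ₁/φ₂` with kernel
`= 𝔭ω` (`pOmega_ker_pr₁_eq`, `pOmega_ker_pr₂_eq`) and surjective — invariant factors `(1, X, X)`, free rank 1,
as in reader 1's ADD-5 §2 (C1)/(C2) and referee C4's hand re-derivation C4-R3.2(d)(iii)); hence over a domain
`X • (ω/𝔭ω)_tors = 0` (`smul_eq_zero_of_mem_torsion₁/₂`) — hypothesis `h2` of Lemma S
(`IwasawaSaturationCriterion.lean`). ON PAPER: BD's ring identification [cite: BetinaDimitrov2021, Thm 2 / 4.8];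
BSTW's `T⁻ ≅ ω_𝒯 ⊗_𝒯 𝒯/𝔭` (arXiv:2409.01350v2 Part I Prop. 4.12, PREPRINT). No census cell is touched.
-/

namespace Literature.NumberTheory.EllipticCurves.IwasawaTransfer

open Submodule Module

namespace BDRingC

variable {Λ : Type*} [CommRing Λ] (X : Λ) (m : ℕ)

/-! #### The `Λ`-dual `ω = Hom_Λ(𝒯, Λ)`, a `𝒯`-module via `(t·f)(s) = f(ts)`, i.e. `t·f = f ∘ₗ mulLeft t` -/

/-- Expansion of a functional in the dual basis of `w₀, w_a, w_Z, w₁`. [folklore] -/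
private theorem dual_apply (f : Module.Dual Λ (Λ × Λ × Λ × Λ)) (a b c d : Λ) :
    f (a, b, c, d) = a * f w₀ + b * f wa + c * f wZ + d * f w₁ := by
  have : ((a, b, c, d) : Λ × Λ × Λ × Λ) = a • (w₀ : Λ × Λ × Λ × Λ) + b • wa + c • wZ + d • w₁ := by
    ext <;> simp [w₀, wa, wZ, w₁]
  rw [this]
  simp only [map_add, map_smul, smul_eq_mul]

/-- Two functionals agreeing on the basis `w₀, w_a, w_Z, w₁` are equal. [folklore] -/
private theorem dual_ext {f g : Module.Dual Λ (Λ × Λ × Λ × Λ)} (h₀ : f w₀ = g w₀) (ha : f wa = g wa)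
    (hZ : f wZ = g wZ) (h₁ : f w₁ = g w₁) : f = g := by
  refine LinearMap.ext fun v => ?_
  obtain ⟨a, b, c, d⟩ := v
  rw [dual_apply f, dual_apply g, h₀, ha, hZ, h₁]

/-- The functional with prescribed values `p, q, r, s` on the basis `w₀, w_a, w_Z, w₁`. [folklore] -/
private def fnl (p q r s : Λ) : Module.Dual Λ (Λ × Λ × Λ × Λ) where
  toFun v := v.1 * p + v.2.1 * q + v.2.2.1 * r + v.2.2.2 * s
  map_add' v w := by simp only [Prod.fst_add, Prod.snd_add]; ring
  map_smul' c v := by simp only [Prod.smul_fst, Prod.smul_snd, smul_eq_mul, RingHom.id_apply]; ring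

/-- Unfolding `fnl`. [folklore] -/
@[simp] private theorem fnl_apply (p q r s : Λ) (v : Λ × Λ × Λ × Λ) :
    fnl p q r s v = v.1 * p + v.2.1 * q + v.2.2.1 * r + v.2.2.2 * s := rfl

/-- `𝔭·ω ⊆ ω = Hom_Λ(𝒯, Λ)`: the `Λ`-span of the functionals `t·f = f ∘ (t·_)`, `t ∈ 𝔭`, `f ∈ ω`. For an
ideal `𝔭` this is the submodule `𝔭ω`, and `ω/𝔭ω = ω ⊗_𝒯 𝒯/𝔭`.
[cite: BurungaleSkinnerTianWan2024, Part I Prop. 4.12 (proof l.3385–3388 `Sat-prop2`: repair step Lemma T = r1 ADD-5 §2; PREPRINT)] -/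
def pOmega (𝔭 : Submodule Λ (Λ × Λ × Λ × Λ)) : Submodule Λ (Module.Dual Λ (Λ × Λ × Λ × Λ)) :=
  span Λ {g | ∃ t ∈ 𝔭, ∃ f : Module.Dual Λ (Λ × Λ × Λ × Λ), f ∘ₗ mulLeft X m t = g}

/-! #### Branch (C1): `𝔭 = ker(π_ψ)`, the kernel of the projection onto the FIRST factor -/

/-- Case (C1): the comparison map `ω → Λ/(X) × Λ/(X) × Λ`, `f ↦ (f(w_Z) mod X, f(w₁) mod X, f(w_a))`.
[cite: BurungaleSkinnerTianWan2024, Part I Prop. 4.12 (proof l.3385–3388 `Sat-prop2`: repair step Lemma T = r1 ADD-5 §2; PREPRINT)] -/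
def φ₁ : Module.Dual Λ (Λ × Λ × Λ × Λ) →ₗ[Λ] (Λ ⧸ Ideal.span {X}) × (Λ ⧸ Ideal.span {X}) × Λ :=
  ((Ideal.span {X}).mkQ ∘ₗ LinearMap.applyₗ (wZ : Λ × Λ × Λ × Λ)).prod
    (((Ideal.span {X}).mkQ ∘ₗ LinearMap.applyₗ (w₁ : Λ × Λ × Λ × Λ)).prod
      (LinearMap.applyₗ (wa : Λ × Λ × Λ × Λ)))

/-- Unfolding `φ₁`. [folklore] -/
@[simp] private theorem φ₁_apply (f : Module.Dual Λ (Λ × Λ × Λ × Λ)) :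
    φ₁ X f = ((Ideal.span {X}).mkQ (f wZ), (Ideal.span {X}).mkQ (f w₁), f wa) := rfl

/-- A functional with `X ∣ g(w_Z)`, `X ∣ g(w₁)`, `g(w_a) = 0` lies in `ker φ₁`. [folklore] -/
private theorem φ₁_eq_zero_of {g : Module.Dual Λ (Λ × Λ × Λ × Λ)} (hZ : X ∣ g wZ) (h₁ : X ∣ g w₁)
    (ha : g wa = 0) : φ₁ X g = 0 := by
  have hZ' : (Ideal.span {X}).mkQ (g wZ) = 0 := (Quotient.mk_eq_zero _).mpr (Ideal.mem_span_singleton.mpr hZ)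
  have h₁' : (Ideal.span {X}).mkQ (g w₁) = 0 := (Quotient.mk_eq_zero _).mpr (Ideal.mem_span_singleton.mpr h₁)
  rw [φ₁_apply, hZ', h₁', ha]; rfl

/-- (C1) `𝔭ω ⊆ ker φ₁`.
[cite: BurungaleSkinnerTianWan2024, Part I Prop. 4.12 (proof l.3385–3388 `Sat-prop2`: repair step Lemma T = r1 ADD-5 §2; PREPRINT)] -/
theorem pOmega_ker_pr₁_le : pOmega X m (LinearMap.ker (pr₁ X)) ≤ LinearMap.ker (φ₁ X) := by
  refine span_le.mpr ?_
  rintro g ⟨t, ht, f, rfl⟩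
  rw [LinearMap.mem_ker, pr₁_apply] at ht
  have ht' : t.1 = -(X * t.2.1) := eq_neg_of_add_eq_zero_left ht
  rw [SetLike.mem_coe, LinearMap.mem_ker]
  refine φ₁_eq_zero_of X ?_ ?_ ?_
  · rw [LinearMap.comp_apply, mulLeft_apply, mul_wZ, dual_apply]
    exact ⟨(-t.2.1 + X ^ m * t.2.2.2) * f wZ + t.2.2.1 * f w₁, by rw [ht']; ring⟩
  · rw [LinearMap.comp_apply, mulLeft_apply, mul_w₁, dual_apply]
    exact ⟨X ^ m * t.2.2.1 * f wZ + (-t.2.1 + X ^ m * t.2.2.2) * f w₁, by rw [ht']; ring⟩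
  · rw [LinearMap.comp_apply, mulLeft_apply, mul_wa, dual_apply, ht]
    ring

/-- (C1) `ker φ₁ ⊆ 𝔭ω`: every such `f` is `u·f'`, `u = X w₀ - w_a ∈ 𝔭`.
[cite: BurungaleSkinnerTianWan2024, Part I Prop. 4.12 (proof l.3385–3388 `Sat-prop2`: repair step Lemma T = r1 ADD-5 §2; PREPRINT)] -/
theorem ker_φ₁_le_pOmega : LinearMap.ker (φ₁ X) ≤ pOmega X m (LinearMap.ker (pr₁ X)) := by
  intro f hf
  rw [LinearMap.mem_ker, φ₁_apply, Prod.mk_eq_zero, Prod.mk_eq_zero] at hf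
  obtain ⟨hZ, h₁, ha⟩ := hf
  obtain ⟨α, hα⟩ := Ideal.mem_span_singleton.mp ((Submodule.Quotient.mk_eq_zero _).mp hZ)
  obtain ⟨β, hβ⟩ := Ideal.mem_span_singleton.mp ((Submodule.Quotient.mk_eq_zero _).mp h₁)
  -- `f = u·f'` with `u = X w₀ - w_a ∈ 𝔭` and `f'` the functional `(0, -f(w₀), α, β)`
  refine subset_span ⟨(X, -1, 0, 0), ?_, fnl 0 (-f w₀) α β, ?_⟩
  · rw [LinearMap.mem_ker, pr₁_apply]; ring
  · refine dual_ext ?_ ?_ ?_ ?_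
    · rw [LinearMap.comp_apply, mulLeft_apply, mul_w₀, fnl_apply]; ring
    · rw [LinearMap.comp_apply, mulLeft_apply, mul_wa, fnl_apply, ha]; ring
    · rw [LinearMap.comp_apply, mulLeft_apply, mul_wZ, fnl_apply, hα]; ring
    · rw [LinearMap.comp_apply, mulLeft_apply, mul_w₁, fnl_apply, hβ]; ring

/-- (C1) `φ₁` is surjective.
[cite: BurungaleSkinnerTianWan2024, Part I Prop. 4.12 (proof l.3385–3388 `Sat-prop2`: repair step Lemma T = r1 ADD-5 §2; PREPRINT)] -/
theorem φ₁_surjective : Function.Surjective (φ₁ X) := by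
  rintro ⟨q₁, q₂, z⟩
  obtain ⟨x, rfl⟩ := (Ideal.span {X}).mkQ_surjective q₁
  obtain ⟨y, rfl⟩ := (Ideal.span {X}).mkQ_surjective q₂
  refine ⟨fnl 0 z x y, ?_⟩
  simp [φ₁_apply, fnl_apply, wZ, w₁, wa]

/-- (C1) `𝔭ω = ker φ₁`.
[cite: BurungaleSkinnerTianWan2024, Part I Prop. 4.12 (proof l.3385–3388 `Sat-prop2`: repair step Lemma T = r1 ADD-5 §2; PREPRINT)] -/
theorem pOmega_ker_pr₁_eq : pOmega X m (LinearMap.ker (pr₁ X)) = LinearMap.ker (φ₁ X) :=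
  le_antisymm (pOmega_ker_pr₁_le X m) (ker_φ₁_le_pOmega X m)

/-- **Lemma T, case (C1)** (kernel form). For BD's ring `𝒯 = Λ ×_k (Λ[Z]/(Z²-X^r) ×_{k[X]/(X^{r-1})} Λ)`
(`r = m + 2`) and `𝔭 = ker π_ψ` the kernel of the projection onto the first factor,
`ω_𝒯/𝔭ω_𝒯 ≅ Λ/(X) ⊕ Λ/(X) ⊕ Λ` as `Λ`-modules.
[cite: BurungaleSkinnerTianWan2024, Part I Prop. 4.12 (proof l.3385–3388 `Sat-prop2`: repair step Lemma T = r1 ADD-5 §2; PREPRINT)] -/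
noncomputable def dualQuotEquiv₁ :
    (Module.Dual Λ (Λ × Λ × Λ × Λ) ⧸ pOmega X m (LinearMap.ker (pr₁ X))) ≃ₗ[Λ]
      (Λ ⧸ Ideal.span {X}) × (Λ ⧸ Ideal.span {X}) × Λ :=
  (Submodule.quotEquivOfEq _ _ (pOmega_ker_pr₁_eq X m)).trans
    ((φ₁ X).quotKerEquivOfSurjective (φ₁_surjective X))

/-- **Lemma T (C1), the form Lemma S consumes**: `X` kills the torsion of `ω_𝒯/𝔭ω_𝒯` (`Λ` a domain).
[cite: BurungaleSkinnerTianWan2024, Part I Prop. 4.12 (proof l.3385–3388 `Sat-prop2`: repair step Lemma T = r1 ADD-5 §2; PREPRINT)] -/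
theorem smul_eq_zero_of_mem_torsion₁ [IsDomain Λ]
    (y : Module.Dual Λ (Λ × Λ × Λ × Λ) ⧸ pOmega X m (LinearMap.ker (pr₁ X)))
    (hy : y ∈ torsion Λ (Module.Dual Λ (Λ × Λ × Λ × Λ) ⧸ pOmega X m (LinearMap.ker (pr₁ X)))) :
    X • y = 0 :=
  smul_eq_zero_of_mem_torsion_of_equiv X (dualQuotEquiv₁ X m) hy

/-! #### Branch (C2): `𝔭 = ker` of the projection onto the INNER factor `Λ` -/

/-- The vector `-X^(r-1) w₀ + X^(r-2) w_a + w₁`, which annihilates `𝔭 = ker pr₂`.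
[cite: BurungaleSkinnerTianWan2024, Part I Prop. 4.12 (proof l.3385–3388 `Sat-prop2`: repair step Lemma T = r1 ADD-5 §2; PREPRINT)] -/
def v₃ : Λ × Λ × Λ × Λ := (-X ^ (m + 1), X ^ m, 0, 1)

/-- `v₃` annihilates `𝔭 = ker pr₂`. [cite: BetinaDimitrov2021, Thm 2 (= Thm 4.8), case (C)] -/
theorem mul_v₃ (t : Λ × Λ × Λ × Λ) (ht : t.1 = 0) : mul X m t (v₃ X m) = 0 := by
  ext <;> simp [mul, v₃, ht] <;> ring

/-- Case (C2): the comparison map `ω → Λ/(X) × Λ/(X) × Λ`,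
`f ↦ (f(w_a) mod X, f(w_Z) mod X, f(-X^(r-1) w₀ + X^(r-2) w_a + w₁))`.
[cite: BurungaleSkinnerTianWan2024, Part I Prop. 4.12 (proof l.3385–3388 `Sat-prop2`: repair step Lemma T = r1 ADD-5 §2; PREPRINT)] -/
def φ₂ : Module.Dual Λ (Λ × Λ × Λ × Λ) →ₗ[Λ] (Λ ⧸ Ideal.span {X}) × (Λ ⧸ Ideal.span {X}) × Λ :=
  ((Ideal.span {X}).mkQ ∘ₗ LinearMap.applyₗ (wa : Λ × Λ × Λ × Λ)).prod
    (((Ideal.span {X}).mkQ ∘ₗ LinearMap.applyₗ (wZ : Λ × Λ × Λ × Λ)).prod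
      (LinearMap.applyₗ (v₃ X m)))

/-- Unfolding `φ₂`. [folklore] -/
@[simp] private theorem φ₂_apply (f : Module.Dual Λ (Λ × Λ × Λ × Λ)) :
    φ₂ X m f = ((Ideal.span {X}).mkQ (f wa), (Ideal.span {X}).mkQ (f wZ), f (v₃ X m)) := rfl

/-- A functional with `X ∣ g(w_a)`, `X ∣ g(w_Z)`, `g(v₃) = 0` lies in `ker φ₂`. [folklore] -/
private theorem φ₂_eq_zero_of {g : Module.Dual Λ (Λ × Λ × Λ × Λ)} (ha : X ∣ g wa) (hZ : X ∣ g wZ)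
    (h3 : g (v₃ X m) = 0) : φ₂ X m g = 0 := by
  have ha' : (Ideal.span {X}).mkQ (g wa) = 0 := (Quotient.mk_eq_zero _).mpr (Ideal.mem_span_singleton.mpr ha)
  have hZ' : (Ideal.span {X}).mkQ (g wZ) = 0 := (Quotient.mk_eq_zero _).mpr (Ideal.mem_span_singleton.mpr hZ)
  rw [φ₂_apply, ha', hZ', h3]; rfl

/-- (C2) `𝔭ω ⊆ ker φ₂`.
[cite: BurungaleSkinnerTianWan2024, Part I Prop. 4.12 (proof l.3385–3388 `Sat-prop2`: repair step Lemma T = r1 ADD-5 §2; PREPRINT)] -/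
theorem pOmega_ker_pr₂_le :
    pOmega X m (LinearMap.ker (pr₂ : (Λ × Λ × Λ × Λ) →ₗ[Λ] Λ)) ≤ LinearMap.ker (φ₂ X m) := by
  refine span_le.mpr ?_
  rintro g ⟨t, ht, f, rfl⟩
  rw [LinearMap.mem_ker, pr₂_apply] at ht
  rw [SetLike.mem_coe, LinearMap.mem_ker]
  refine φ₂_eq_zero_of X m ?_ ?_ ?_
  · rw [LinearMap.comp_apply, mulLeft_apply, mul_wa, dual_apply, ht]
    exact ⟨t.2.1 * f wa, by ring⟩
  · rw [LinearMap.comp_apply, mulLeft_apply, mul_wZ, dual_apply, ht]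
    exact ⟨X ^ m * t.2.2.2 * f wZ + t.2.2.1 * f w₁, by ring⟩
  · rw [LinearMap.comp_apply, mulLeft_apply, mul_v₃ X m t ht, map_zero]

/-- (C2) `ker φ₂ ⊆ 𝔭ω`: every such `f` is `w_a·(0,α,0,0) + w_Z·(0,0,f(w₀)-α,β)`.
[cite: BurungaleSkinnerTianWan2024, Part I Prop. 4.12 (proof l.3385–3388 `Sat-prop2`: repair step Lemma T = r1 ADD-5 §2; PREPRINT)] -/
theorem ker_φ₂_le_pOmega :
    LinearMap.ker (φ₂ X m) ≤ pOmega X m (LinearMap.ker (pr₂ : (Λ × Λ × Λ × Λ) →ₗ[Λ] Λ)) := by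
  intro f hf
  rw [LinearMap.mem_ker, φ₂_apply, Prod.mk_eq_zero, Prod.mk_eq_zero] at hf
  obtain ⟨ha, hZ, h3⟩ := hf
  obtain ⟨α, hα⟩ := Ideal.mem_span_singleton.mp ((Submodule.Quotient.mk_eq_zero _).mp ha)
  obtain ⟨β, hβ⟩ := Ideal.mem_span_singleton.mp ((Submodule.Quotient.mk_eq_zero _).mp hZ)
  rw [v₃, dual_apply] at h3
  -- `f = w_a·(0, α, 0, 0) + w_Z·(0, 0, f(w₀) - α, β)`
  have hf : f = fnl 0 α 0 0 ∘ₗ mulLeft X m wa + fnl 0 0 (f w₀ - α) β ∘ₗ mulLeft X m wZ := by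
    refine dual_ext ?_ ?_ ?_ ?_
    · rw [LinearMap.add_apply, LinearMap.comp_apply, LinearMap.comp_apply, mulLeft_apply,
        mulLeft_apply, mul_w₀, mul_w₀, wa, wZ, fnl_apply, fnl_apply]
      ring
    · rw [hα, LinearMap.add_apply, LinearMap.comp_apply, LinearMap.comp_apply, mulLeft_apply,
        mulLeft_apply, mul_wa, mul_wa, wa, wZ, fnl_apply, fnl_apply]
      ring
    · rw [hβ, LinearMap.add_apply, LinearMap.comp_apply, LinearMap.comp_apply, mulLeft_apply,
        mulLeft_apply, mul_wZ, mul_wZ, wa, wZ, fnl_apply, fnl_apply]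
      ring
    · rw [LinearMap.add_apply, LinearMap.comp_apply, LinearMap.comp_apply, mulLeft_apply,
        mulLeft_apply, mul_w₁, mul_w₁, wa, wZ, fnl_apply, fnl_apply]
      linear_combination h3 - X ^ m * hα
  rw [hf]
  refine add_mem (subset_span ⟨wa, ?_, _, rfl⟩) (subset_span ⟨wZ, ?_, _, rfl⟩)
  · rw [LinearMap.mem_ker, pr₂_apply, wa]
  · rw [LinearMap.mem_ker, pr₂_apply, wZ]

/-- (C2) `φ₂` is surjective.
[cite: BurungaleSkinnerTianWan2024, Part I Prop. 4.12 (proof l.3385–3388 `Sat-prop2`: repair step Lemma T = r1 ADD-5 §2; PREPRINT)] -/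
theorem φ₂_surjective : Function.Surjective (φ₂ X m) := by
  rintro ⟨q₁, q₂, z⟩
  obtain ⟨x, rfl⟩ := (Ideal.span {X}).mkQ_surjective q₁
  obtain ⟨y, rfl⟩ := (Ideal.span {X}).mkQ_surjective q₂
  refine ⟨fnl 0 x y (z - X ^ m * x), ?_⟩
  rw [φ₂_apply, v₃]
  simp only [fnl_apply, wa, wZ]
  refine Prod.ext (by simp) (Prod.ext (by simp) ?_)
  simp only [mul_zero, zero_mul, zero_add, one_mul]
  ring

/-- (C2) `𝔭ω = ker φ₂`.
[cite: BurungaleSkinnerTianWan2024, Part I Prop. 4.12 (proof l.3385–3388 `Sat-prop2`: repair step Lemma T = r1 ADD-5 §2; PREPRINT)] -/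
theorem pOmega_ker_pr₂_eq :
    pOmega X m (LinearMap.ker (pr₂ : (Λ × Λ × Λ × Λ) →ₗ[Λ] Λ)) = LinearMap.ker (φ₂ X m) :=
  le_antisymm (pOmega_ker_pr₂_le X m) (ker_φ₂_le_pOmega X m)

/-- **Lemma T, case (C2)** (kernel form). For BD's ring `𝒯 = Λ ×_k (Λ[Z]/(Z²-X^r) ×_{k[X]/(X^{r-1})} Λ)`
(`r = m + 2`) and `𝔭` the kernel of the projection onto the INNER factor `Λ` (the other CM branch),
`ω_𝒯/𝔭ω_𝒯 ≅ Λ/(X) ⊕ Λ/(X) ⊕ Λ` as `Λ`-modules.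
[cite: BurungaleSkinnerTianWan2024, Part I Prop. 4.12 (proof l.3385–3388 `Sat-prop2`: repair step Lemma T = r1 ADD-5 §2; PREPRINT)] -/
noncomputable def dualQuotEquiv₂ :
    (Module.Dual Λ (Λ × Λ × Λ × Λ) ⧸ pOmega X m (LinearMap.ker (pr₂ : (Λ × Λ × Λ × Λ) →ₗ[Λ] Λ)))
      ≃ₗ[Λ] (Λ ⧸ Ideal.span {X}) × (Λ ⧸ Ideal.span {X}) × Λ :=
  (Submodule.quotEquivOfEq _ _ (pOmega_ker_pr₂_eq X m)).trans
    ((φ₂ X m).quotKerEquivOfSurjective (φ₂_surjective X m))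

/-- **Lemma T (C2), the form Lemma S consumes**: `X` kills the torsion of `ω_𝒯/𝔭ω_𝒯` (`Λ` a domain).
[cite: BurungaleSkinnerTianWan2024, Part I Prop. 4.12 (proof l.3385–3388 `Sat-prop2`: repair step Lemma T = r1 ADD-5 §2; PREPRINT)] -/
theorem smul_eq_zero_of_mem_torsion₂ [IsDomain Λ]
    (y : Module.Dual Λ (Λ × Λ × Λ × Λ) ⧸ pOmega X m (LinearMap.ker (pr₂ : (Λ × Λ × Λ × Λ) →ₗ[Λ] Λ)))
    (hy : y ∈ torsion Λ
      (Module.Dual Λ (Λ × Λ × Λ × Λ) ⧸ pOmega X m (LinearMap.ker (pr₂ : (Λ × Λ × Λ × Λ) →ₗ[Λ] Λ)))) :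
    X • y = 0 :=
  smul_eq_zero_of_mem_torsion_of_equiv X (dualQuotEquiv₂ X m) hy

end BDRingC

end Literature.NumberTheory.EllipticCurves.IwasawaTransfer
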